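import Literature.Computability.QuantumComplexity.ForrelationDerivativeTables
import Literature.Computability.QuantumComplexity.ForrelationDirectSum

/-!
# Crux `CubicForrelation.NearExactIsExact` (stmt-QuantumAdvantage-14043), line `direct-sum-amplification` —
stub PR: rows of the derivative Walsh table move by at most `4·wt(e)` under `a ↦ a ⊕ e`

**What.** For Boolean `a, e : 𝔽₂ⁿ → 𝔽₂` and `u, v ∈ 𝔽₂ⁿ`, the entry `(u, v)` of the derivative Walsh table
`T_F(u,v) = Σ_x F(x) F(x ⊕ u) (-1)^{v·x}` (`DerivativeWalsh.dwt F u v`) of `F' = (-1)^{a ⊕ e}` differs from the same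
entry for `F = (-1)^a` by at most `4 · wt(e)`, `wt(e) = #{x | e x = 1}` (`stub_perturbRow`). In the line this is fed
with the dual `d = a ⊕ e` of a bent `g`, `e` of small weight: row `u` of `T_d` is uniformly `4·wt(e)`-close to row
`u` of `T_a`.

**Proof.** Termwise `F'(x) F'(x ⊕ u) = F(x) F(x ⊕ u) · (-1)^{e(x)} (-1)^{e(x ⊕ u)}` (`signOf_xor`), so the two
summands agree when `e(x) = e(x ⊕ u) = 0`, and otherwise differ by at most `|F'F't| + |FFt| = 2`; in both cases the
difference is `≤ 2([e x] + [e (x ⊕ u)])` (`pr_term`, a `32`-case check on the four Booleans and the sign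
`t = (-1)^{v·x} = ±1`). Summing, `|T_{F'}(u,v) - T_F(u,v)| ≤ 2 Σ_x [e x] + 2 Σ_x [e (x ⊕ u)] = 4 wt(e)`, the second
sum being `wt(e)` by the reindexing `x ↦ u ⊕ x` (`bxorPerm u`). Pure finite sums; no degree hypotheses.

References (orientation; everything here is proved from scratch): C. Carlet, *Boolean Functions for Cryptography
and Coding Theory* (CUP 2021), §2.3 (Walsh transform of a derivative); R. O'Donnell, *Analysis of Boolean Functions*
(CUP 2014), §1.4 (characters).
-/

set_option linter.dupNamespace false -- D-0017: single-problem summit ⇒ `QuantumAdvantage.QuantumAdvantage` by design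

noncomputable section

namespace Summit.QuantumAdvantage.QuantumAdvantage.Theorems.CubicForrelation.NearExactIsExact

open Finset
open Literature.Computability.QuantumComplexity
open Literature.Computability.QuantumComplexity.BuzetChailloux (bxor bxorPerm bxorPerm_apply bxor_comm)
open Literature.Computability.QuantumComplexity.DerivativeWalsh (dwt)

/-- **Termwise bound.** For Booleans `p q r s` and a sign `t = ±1`,
`|σ(p ⊕ r) σ(q ⊕ s) t - σ(p) σ(q) t| ≤ 2 [r] + 2 [s]` with `σ = signOf = (-1)^{·}`: both sides vanish when
`r = s = 0`, and otherwise the left side is `≤ 2`. [folklore] -/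
theorem pr_term (p q r s : Bool) (t : ℝ) (ht : t = 1 ∨ t = -1) :
    |signOf (p ^^ r) * signOf (q ^^ s) * t - signOf p * signOf q * t| ≤
      2 * (if r = true then (1 : ℝ) else 0) + 2 * (if s = true then (1 : ℝ) else 0) := by
  rcases ht with rfl | rfl <;> cases p <;> cases q <;> cases r <;> cases s <;> norm_num [signOf]

/-- **Translation invariance of the weight.** `Σ_x [e (x ⊕ u)] = wt(e)`: reindex by the involution `x ↦ u ⊕ x`
(`bxorPerm u`). [folklore] -/
theorem pr_sum_indicator_bxor {n : ℕ} (e : (Fin n → Bool) → Bool) (u : Fin n → Bool) :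
    ∑ x : Fin n → Bool, (if e (bxor x u) = true then (1 : ℝ) else 0) =
      ((univ.filter fun x => e x = true).card : ℝ) := by
  rw [natCast_card_filter]
  exact Fintype.sum_equiv (bxorPerm u) _ _ fun x => by rw [bxorPerm_apply, bxor_comm]

/-- **stub_perturbRow** (PR). Xoring `e` into `a` moves every entry of row `u` of the derivative Walsh table by at
most `4·wt(e)`: `|T_{(-1)^{a ⊕ e}}(u,v) - T_{(-1)^a}(u,v)| ≤ 4 · #{x | e x = 1}`. Termwise
`|(-1)^{D_u(a⊕e)(x)} − (-1)^{D_u a(x)}| ≤ 2([e x] + [e (x ⊕ u)])` (`pr_term`), and `x ↦ x ⊕ u` is a bijection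
(`pr_sum_indicator_bxor`). [folklore] -/
theorem stub_perturbRow :
    ∀ (n : ℕ) (a e : (Fin n → Bool) → Bool) (u v : Fin n → Bool),
      |dwt (fun x => signOf (a x ^^ e x)) u v - dwt (fun x => signOf (a x)) u v| ≤
        4 * ((univ.filter fun x => e x = true).card : ℝ) := by
  intro n a e u v
  have hwt : ∑ x : Fin n → Bool, (if e x = true then (1 : ℝ) else 0) =
      ((univ.filter fun x => e x = true).card : ℝ) := by
    rw [natCast_card_filter]
  unfold dwt
  rw [← sum_sub_distrib]
  calc |∑ x, (signOf (a x ^^ e x) * signOf (a (bxor x u) ^^ e (bxor x u)) * twist v x -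
          signOf (a x) * signOf (a (bxor x u)) * twist v x)|
      ≤ ∑ x, |signOf (a x ^^ e x) * signOf (a (bxor x u) ^^ e (bxor x u)) * twist v x -
          signOf (a x) * signOf (a (bxor x u)) * twist v x| := abs_sum_le_sum_abs _ _
    _ ≤ ∑ x, (2 * (if e x = true then (1 : ℝ) else 0) +
          2 * (if e (bxor x u) = true then (1 : ℝ) else 0)) :=
        sum_le_sum fun x _ => pr_term _ _ _ _ _ (Simon.twist_eq_one_or v x)
    _ = 4 * ((univ.filter fun x => e x = true).card : ℝ) := by
        rw [sum_add_distrib, ← mul_sum, ← mul_sum, hwt, pr_sum_indicator_bxor e u]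
        ring

end Summit.QuantumAdvantage.QuantumAdvantage.Theorems.CubicForrelation.NearExactIsExact
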